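import Summits.CriticalPhenomena.PercolationContinuityZ3.Theorems.Transplant.FKConnectivityAllQAntipodalX2SpinePair
import HarnessLib

/-!
# Connectivity correlation inequalities for `φ_{w,q}` — the spine of a marked edge, file 6: ROW SEMANTICS along a spine
# ((S2) of memo g13 §7.3: the sign and the cluster exponent of a configuration factor through its word)

Helper file (`--supports stmt-CriticalPhenomena-4575`), FK sub-lane `prim-bschramm-fk-2` (gen 14); builds on p205010 (kernel
theorem, internal audit signed; external expert review pending).  No definitions, no named facts, no sorries; standard axioms.

For a spine `IsSpine ps M a b E s t` (file `…X2SpineDefs`) and a configuration `ω ⊆ E`, with `c₀ = 1{a ↔ b in ω ∩ M}` and `rowOf ps ω`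
the row word of `ω` (the kinds of the visible parts: walls = non-joining series parts, particles = joining parallel parts):
* `FK.IsSpine.reach_iff` — `1{s ↔ t in ω} = lastFlag c₀ (rowOf ps ω)` ("the last block contains a particle", memo g12 §4.2: `C`);
* `FK.IsSpine.clusterCount_eq` — `k(ω) + L·|V| = k(ω ∩ M) + Σ_p k(ω ∩ R_p) + adjP c₀ (rowOf ps ω)` (the `corr` of memo g12 §4.2:
  one saved cluster per adjacent particle pair);
* `FK.IsSpine.pairState_holds` — the pair-state automaton `runK` run on the row word from a state holding for `(ω ∩ M; a, b)` ends in
  a state holding for `(ω; s, t)` (memo g12 §1.4);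
and, for the spine of a MARKED EDGE `z = uv` (`M = {z}`, terminals `u, v`) and a configuration avoiding `z`:
`FK.IsSpine.apConn_terminals_eq` (`1{s ↔ t in ω} = lastP (rowOf ps ω)`), `FK.IsSpine.apConn_marked_eq`
(`1{u ↔ v in ω} = headP (rowOf ps ω)`: "the first block contains a particle", `K` of memo g12 §4.2), `FK.IsSpine.clusterCount_marked`
(`k(ω) + L·|V| = |V| + Σ_p k(ω ∩ R_p) + adjP false (rowOf ps ω)`).
[cite: Grimmett2006, §1.4 eq. (1.20) (p. 15); §3.9 (p. 63)]
-/

namespace Summit.CriticalPhenomena.PercolationContinuityZ3.Theorems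

namespace FK

open SimpleGraph Literature.Probability.LatticeModels Literature.Probability.Percolation X2Word
open scoped Classical

variable {V : Type*}

/-! ### The three inductions along a spine -/

section Along

variable {ps : List (SpinePart V)} {M E : Finset (Sym2 V)} {a b s t : V}

/-- **Terminal connection factors through the row word**: `1{s ↔ t in ω} = lastFlag (1{a ↔ b in ω ∩ M}) (rowOf ps ω)`. [folklore] -/
theorem IsSpine.reach_iff (h : IsSpine ps M a b E s t) (hab : a ≠ b) (ω : Finset (Sym2 V)) (hω : ω ⊆ E) {c₀ : Bool}
    (hc : c₀ = true ↔ (openGraph (↑(ω ∩ M) : BondConfig V)).Reachable a b) :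
    lastFlag c₀ (rowOf ps ω) = true ↔ (openGraph (↑ω : BondConfig V)).Reachable s t := by
  induction ps generalizing M a b c₀ with
  | nil =>
    obtain ⟨rfl, rfl, rfl⟩ := h
    rw [rowOf_nil, lastFlag_nil, hc, Finset.inter_eq_left.2 hω]
  | cons p ps ih =>
    obtain ⟨a', b', hg, hrest⟩ := h
    rw [rowOf_cons, lastFlag_append]
    exact ih hrest (hg.ne hab) (hg.reach_step hab ω hc)

/-- **The marked pair's state factors through the row word**: the automaton `runK`, started in a state that holds for `(ω ∩ M; a, b)`,
ends in a state that holds for `(ω; s, t)` (`u, v` vertices of the inner composite). [folklore] -/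
theorem IsSpine.pairState_holds (h : IsSpine ps M a b E s t) {u v : V} (hu : ∃ e ∈ M, u ∈ e) (hv : ∃ e ∈ M, v ∈ e)
    (ω : Finset (Sym2 V)) (hω : ω ⊆ E) {st : PairState} (hst : st.Holds (↑(ω ∩ M) : BondConfig V) a b u v) :
    (runK st (rowOf ps ω)).Holds (↑ω : BondConfig V) s t u v := by
  induction ps generalizing M a b st with
  | nil =>
    obtain ⟨rfl, rfl, rfl⟩ := h
    rw [rowOf_nil, runK_nil]
    rwa [Finset.inter_eq_left.2 hω] at hst
  | cons p ps ih =>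
    obtain ⟨a', b', hg, hrest⟩ := h
    rw [rowOf_cons, runK_append]
    exact ih hrest (span_mono_union hu) (span_mono_union hv) (hg.pairState_step hu hv ω hst)

variable [Fintype V]

/-- **The cluster count factors through the row word**: `k(ω) + L·|V| = k(ω ∩ M) + Σ_p k(ω ∩ R_p) + adjP (1{a ↔ b in ω ∩ M}) (rowOf ps ω)`.
[cite: Grimmett2006, §1.4 eq. (1.20) (p. 15)] -/
theorem IsSpine.clusterCount_eq (h : IsSpine ps M a b E s t) (hab : a ≠ b) (ω : Finset (Sym2 V)) (hω : ω ⊆ E) {c₀ : Bool}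
    (hc : c₀ = true ↔ (openGraph (↑(ω ∩ M) : BondConfig V)).Reachable a b) :
    clusterCount (↑ω : BondConfig V) ∅ + ps.length * Fintype.card V =
      clusterCount (↑(ω ∩ M) : BondConfig V) ∅ + (ps.map fun p => clusterCount (↑(ω ∩ p.R) : BondConfig V) ∅).sum +
        adjP c₀ (rowOf ps ω) := by
  induction ps generalizing M a b c₀ with
  | nil =>
    obtain ⟨rfl, rfl, rfl⟩ := h
    rw [rowOf_nil, adjP_nil, Finset.inter_eq_left.2 hω]
    simp
  | cons p ps ih =>
    obtain ⟨a', b', hg, hrest⟩ := h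
    have ih' := ih hrest (hg.ne hab) (hg.reach_step hab ω hc)
    have step := hg.clusterCount_step hab ω hc
    rw [rowOf_cons, adjP_append, List.length_cons, List.map_cons, List.sum_cons, Nat.succ_mul]
    omega

end Along

/-! ### The spine of a marked edge: configurations avoiding the marked edge -/

section Marked

variable {ps : List (SpinePart V)} {E : Finset (Sym2 V)} {s t u v : V}

/-- A configuration avoiding the marked edge meets `{z}` in nothing. [folklore] -/
theorem coe_inter_singleton_of_not_mem {ω : Finset (Sym2 V)} {z : Sym2 V} (hz : z ∉ ω) :
    (↑(ω ∩ {z}) : Set (Sym2 V)) = ∅ := by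
  rw [Finset.inter_singleton_of_notMem hz, Finset.coe_empty]

/-- In the empty configuration only equal vertices are joined. [folklore] -/
theorem reachable_empty_iff {x y : V} : (openGraph (∅ : BondConfig V)).Reachable x y ↔ x = y := by
  have h0 : openGraph (∅ : BondConfig V) = ⊥ := by rw [openGraph, fromEdgeSet_empty]
  rw [h0, reachable_bot]

/-- The flag started at `false` is the last letter. [folklore] -/
theorem lastFlag_false (l : List Kind) : lastFlag false l = lastP l := by
  cases l with
  | nil => rfl
  | cons k l => exact lastFlag_of_ne_nil _ (List.cons_ne_nil _ _)

/-- **`1{s ↔ t in ω} = lastP (rowOf ps ω)`** for the spine of the marked edge `uv` and a configuration `ω ⊆ E` avoiding it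
("the last block of the row contains a particle", `C` of memo g12 §4.2). [folklore] -/
theorem IsSpine.apConn_terminals_eq (h : IsSpine ps {s(u, v)} u v E s t) (huv : u ≠ v) {ω : Finset (Sym2 V)} (hω : ω ⊆ E)
    (hz : s(u, v) ∉ ω) : apConn ω s t = if lastP (rowOf ps ω) then 1 else 0 := by
  have hc : false = true ↔ (openGraph (↑(ω ∩ {s(u, v)}) : BondConfig V)).Reachable u v := by
    rw [coe_inter_singleton_of_not_mem hz, reachable_empty_iff]
    exact ⟨fun h => absurd h Bool.false_ne_true, fun h => absurd h huv⟩
  have key := h.reach_iff huv ω hω hc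
  rw [lastFlag_false] at key
  unfold apConn
  by_cases hr : (openGraph (↑ω : BondConfig V)).Reachable s t
  · rw [if_pos hr, if_pos (key.2 hr)]
  · rw [if_neg hr, if_neg (fun h => hr (key.1 h))]

/-- **`1{u ↔ v in ω} = headP (rowOf ps ω)`** for the spine of the marked edge `uv` and a configuration `ω ⊆ E` avoiding it ("the first
block of the row contains a particle", `K` of memo g12 §4.2: started straddling, the pair is joined by the first particle unless a wall
comes first). [folklore] -/
theorem IsSpine.apConn_marked_eq (h : IsSpine ps {s(u, v)} u v E s t) (huv : u ≠ v) {ω : Finset (Sym2 V)} (hω : ω ⊆ E)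
    (hz : s(u, v) ∉ ω) : apConn ω u v = if headP (rowOf ps ω) then 1 else 0 := by
  have hst : PairState.S.Holds (↑(ω ∩ {s(u, v)}) : BondConfig V) u v u v := by
    rw [coe_inter_singleton_of_not_mem hz]
    simp only [PairState.Holds]
    exact ⟨fun hr => huv (reachable_empty_iff.1 hr), Reachable.refl _, Reachable.refl _⟩
  have key := h.pairState_holds ⟨s(u, v), Finset.mem_singleton_self _, Sym2.mem_mk_left _ _⟩
    ⟨s(u, v), Finset.mem_singleton_self _, Sym2.mem_mk_right _ _⟩ ω hω hst
  unfold apConn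
  cases hrow : rowOf ps ω with
  | nil =>
    rw [hrow, runK_nil] at key
    simp only [PairState.Holds] at key
    rw [if_neg key.1]; rfl
  | cons k l =>
    rw [hrow] at key
    cases k with
    | P =>
      simp only [runK, PairState.Holds] at key
      rw [if_pos key]; rfl
    | W =>
      simp only [runK, PairState.Holds] at key
      have key' : ¬ (openGraph (↑ω : BondConfig V)).Reachable u v :=
        fun hr => key (hr.mono (openGraph_mono Set.subset_union_left))
      rw [if_neg key']; rfl

variable [Fintype V]

/-- **`k(ω) + L·|V| = |V| + Σ_p k(ω ∩ R_p) + adjP false (rowOf ps ω)`** for the spine of the marked edge and a configuration avoiding it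
(the `corr` of memo g12 §4.2). [cite: Grimmett2006, §1.4 eq. (1.20) (p. 15)] -/
theorem IsSpine.clusterCount_marked (h : IsSpine ps {s(u, v)} u v E s t) (huv : u ≠ v) {ω : Finset (Sym2 V)} (hω : ω ⊆ E)
    (hz : s(u, v) ∉ ω) :
    clusterCount (↑ω : BondConfig V) ∅ + ps.length * Fintype.card V =
      Fintype.card V + (ps.map fun p => clusterCount (↑(ω ∩ p.R) : BondConfig V) ∅).sum + adjP false (rowOf ps ω) := by
  have hc : false = true ↔ (openGraph (↑(ω ∩ {s(u, v)}) : BondConfig V)).Reachable u v := by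
    rw [coe_inter_singleton_of_not_mem hz, reachable_empty_iff]
    exact ⟨fun h => absurd h Bool.false_ne_true, fun h => absurd h huv⟩
  have key := h.clusterCount_eq huv ω hω hc
  rw [coe_inter_singleton_of_not_mem hz, clusterCount_empty_card] at key
  exact key

end Marked

end FK

end Summit.CriticalPhenomena.PercolationContinuityZ3.Theorems
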